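import Literature.Barriers.ValiantsHypothesis.FullRankMultilinearCircuit
import Mathlib.Algebra.MvPolynomial.PDeriv
import Mathlib.Algebra.MvPolynomial.Supported
import Mathlib.Data.List.GetD
import Mathlib.Algebra.Order.Interval.Finset.SuccPred
import HarnessLib

/-!
# Syntactically multilinear circuits: bookkeeping and the multilinear Baur–Strassen theorem
(Raz–Shpilka–Yehudayoff 2008, Thm. 3.1 = Alon–Kumar–Volk 2020, Thm. 21)

Support file for the proof of `Literature.Barriers.ValiantsHypothesis.AlonKumarVolk2020_thm20`
(`FullRankMultilinear.lean`), on the tree's list model of circuits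
(`Literature.Computability.AlgebraicComplexity.ArithCircuit`: a list of gates, absolute gate
references, total left-fold semantics `gateValues`, syntactic variable sets `gateVarSets`).

* Bookkeeping: `gateValues` / `gateVarSets` are the same left fold (`foldSnoc`); prefix and
  `take` lemmas, the value / variable set of gate `i` (`getD_gateValues`, `getD_gateVarSets`),
  monotonicity of variable sets along references (`gateVarSets_mono_of_mem_args`), and
  `gateValues_mem_supported`: the value of gate `i` lies in `K[X_i]`.
* **The multilinear Baur–Strassen construction** [AlonKumarVolk2020, Thm. 21] (= RSY08,
  Thm. 3.1), as a reverse sweep over the gates `p = s-1, …, 0` keeping an accumulator operand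
  `acc j` for the adjoint `∂f/∂v_j` of every gate and `dacc x` for `∂f/∂x` (`push`, `step`,
  `run`, `derivGates`, `derivOut`, `derivCircuit`): for each of the two slots `(u, w)` of gate
  `p` (`slotOp`, `slotWt`: `w` a scalar for sum gates, the other operand for product gates) the
  contribution `acc p · w` is added to the accumulator of `u` with at most two new gates, so
  `|Ψ'| ≤ 5|Ψ|` (`derivGates_length_le`).
* Correctness (`derivCircuit_eval`: the output for `x` computes `∂f/∂x`, `f` the value of the
  last gate) is the transposition principle: the tangents `T_p = ∂v_p/∂x` solve the forward
  triangular system `T_p = b_p + ∑_{j<p} M_{pj} T_j` (`tangent_recurrence`, the chain rule at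
  a gate), the final accumulators solve the backward one `ā_j = e_j + ∑_{p>j} ā_p M_{pj}`
  (`adjoint_recurrence`, by the invariant `run_eval` of the sweep), whence
  `∑ e_j T_j = ∑ ā_p b_p` (`duality`).
* Syntax (`derivCircuit_sm`, `not_mem_operandVarSet_derivOut`): the new product gates
  multiply `acc p` (variables disjoint from `X_p`, invariant `SInv`) with an operand of gate `p`
  (variables inside `X_p`), so `Ψ'` is syntactically multilinear, and `x ∉ X_{v_x}` for the
  output `v_x` computing `∂f/∂x` — items (3), (4) of [AlonKumarVolk2020, Thm. 21].

## References
* [AlonKumarVolk2020] N. Alon, M. Kumar, B. L. Volk, Combinatorica 40 (2020), §4, Thm. 21.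
* [RazYehudayoff2008] R. Raz, A. Yehudayoff, Comput. Complexity 17 (2008), §2 (the model).
-/

noncomputable section

namespace Literature.Barriers.ValiantsHypothesis.AKV

open MvPolynomial Literature.Computability.AlgebraicComplexity
open Literature.Computability.AlgebraicComplexity.ArithCircuit

universe u v

/-! ### The left fold shared by `gateValues` and `gateVarSets` -/

section FoldSnoc

variable {α β : Type*}

/-- `foldSnoc F l`: the list built by a left fold appending `F (list so far) a` for each `a`
(the common shape of `ArithCircuit.gateValues` and `gateVarSets`). [folklore] -/
def foldSnoc (F : List β → α → β) (l : List α) : List β :=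
  l.foldl (fun acc a => acc ++ [F acc a]) []

/-- One step of the fold. [folklore] -/
theorem foldSnoc_append_singleton (F : List β → α → β) (l : List α) (a : α) :
    foldSnoc F (l ++ [a]) = foldSnoc F l ++ [F (foldSnoc F l) a] := by
  simp [foldSnoc, List.foldl_append]

/-- The fold has one entry per input. [folklore] -/
@[simp] theorem foldSnoc_length (F : List β → α → β) (l : List α) :
    (foldSnoc F l).length = l.length := by
  induction l using List.reverseRecOn with
  | nil => rfl
  | append_singleton l a ih => simp [foldSnoc_append_singleton, ih]

/-- The fold of a prefix is a prefix of the fold. [folklore] -/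
theorem foldSnoc_prefix (F : List β → α → β) (l l' : List α) :
    foldSnoc F l <+: foldSnoc F (l ++ l') := by
  induction l' using List.reverseRecOn with
  | nil => simp
  | append_singleton l' a ih =>
    rw [← List.append_assoc, foldSnoc_append_singleton]
    exact ih.trans (List.prefix_append _ _)

/-- `foldSnoc` commutes with `take`. [folklore] -/
theorem foldSnoc_take (F : List β → α → β) (l : List α) {i : ℕ} (hi : i ≤ l.length) :
    foldSnoc F (l.take i) = (foldSnoc F l).take i := by
  have h := foldSnoc_prefix F (l.take i) (l.drop i)
  rw [List.take_append_drop] at h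
  obtain ⟨t, ht⟩ := h
  have hlen : (foldSnoc F (l.take i)).length = i := by
    rw [foldSnoc_length, List.length_take, min_eq_left hi]
  rw [← ht]
  exact (List.take_left' hlen).symm

/-- The `i`-th entry of the fold is `F` applied to the first `i` entries and the `i`-th input.
[folklore] -/
theorem getElem?_foldSnoc (F : List β → α → β) (l : List α) {i : ℕ} (hi : i < l.length) :
    (foldSnoc F l)[i]? = some (F (foldSnoc F (l.take i)) (l[i])) := by
  have h1 : foldSnoc F (l.take (i + 1)) = foldSnoc F (l.take i) ++ [F (foldSnoc F (l.take i)) (l[i])] := by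
    rw [List.take_add_one, List.getElem?_eq_getElem hi, Option.toList_some, foldSnoc_append_singleton]
  have h2 : (foldSnoc F l)[i]? = ((foldSnoc F l).take (i + 1))[i]? := by
    rw [List.getElem?_take_of_lt (Nat.lt_succ_self i)]
  rw [h2, ← foldSnoc_take F l hi, h1, List.getElem?_append_right]
  · have hlen : (foldSnoc F (l.take i)).length = i := by
      rw [foldSnoc_length, List.length_take, min_eq_left hi.le]
    simp [hlen]
  · rw [foldSnoc_length, List.length_take, min_eq_left hi.le]

/-- `getD` form of `getElem?_foldSnoc`. [folklore] -/
theorem getD_foldSnoc (F : List β → α → β) (l : List α) {i : ℕ} (hi : i < l.length) (d : β) :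
    (foldSnoc F l).getD i d = F (foldSnoc F (l.take i)) (l[i]) := by
  rw [List.getD_eq_getElem?_getD, getElem?_foldSnoc F l hi, Option.getD_some]

/-- Entries of the fold of a prefix. [folklore] -/
theorem getD_foldSnoc_take (F : List β → α → β) (l : List α) {i n : ℕ} (hin : i < n)
    (hn : n ≤ l.length) (d : β) : (foldSnoc F (l.take n)).getD i d = (foldSnoc F l).getD i d := by
  rw [foldSnoc_take F l hn, List.getD_eq_getElem?_getD, List.getD_eq_getElem?_getD,
    List.getElem?_take_of_lt hin]

end FoldSnoc

/-! ### Operands: scoping, truncation, values and variable sets -/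

section Operands

variable {k : Type u} {σ : Type v}

/-- `RefsBelow` is monotone in the bound. [folklore] -/
theorem refsBelow_mono {u : Operand k σ} {n m : ℕ} (h : u.RefsBelow n) (hnm : n ≤ m) :
    u.RefsBelow m := by
  cases u with
  | var i => trivial
  | const c => trivial
  | gate j => exact lt_of_lt_of_le h hnm

/-- A truncated operand refers below the truncation point. [folklore] -/
theorem refsBelow_truncate [Zero k] (u : Operand k σ) (p : ℕ) : (u.truncate p).RefsBelow p := by
  cases u with
  | var i => trivial
  | const c => trivial
  | gate j =>
    by_cases h : j < p
    · simp only [Operand.truncate, if_pos h]; exact h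
    · simp only [Operand.truncate, if_neg h]; trivial

/-- A gate reference refers below `n` iff its index is `< n`. [folklore] -/
@[simp] theorem refsBelow_gate_iff (j n : ℕ) : (Operand.gate j : Operand k σ).RefsBelow n ↔ j < n :=
  Iff.rfl

variable [CommSemiring k]

/-- An operand referring below `n` reads only the first `n` values. [folklore] -/
theorem eval_take_of_refsBelow (u : Operand k σ) (L : List (MvPolynomial σ k)) {n : ℕ}
    (hu : u.RefsBelow n) : u.eval (L.take n) = u.eval L := by
  cases u with
  | var i => rfl
  | const c => rfl
  | gate j =>
    simp only [Operand.eval_gate, List.getD_eq_getElem?_getD]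
    rw [List.getElem?_take_of_lt hu]

/-- An operand referring below `L.length` ignores appended values. [folklore] -/
theorem eval_append_of_refsBelow (u : Operand k σ) (L L' : List (MvPolynomial σ k))
    (hu : u.RefsBelow L.length) : u.eval (L ++ L') = u.eval L := by
  rw [← eval_take_of_refsBelow u (L ++ L') hu, List.take_left']
  rfl

/-- Truncating at `p ≤ L.length` = evaluating against the first `p` values. [folklore] -/
theorem eval_truncate_eq_eval_take (u : Operand k σ) (L : List (MvPolynomial σ k)) {p : ℕ}
    (hp : p ≤ L.length) : (u.truncate p).eval L = u.eval (L.take p) := by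
  cases u with
  | var i => rfl
  | const c => rfl
  | gate j =>
    by_cases h : j < p
    · simp only [Operand.truncate, if_pos h, Operand.eval_gate, List.getD_eq_getElem?_getD]
      rw [List.getElem?_take_of_lt h]
    · simp only [Operand.truncate, if_neg h, Operand.eval, List.getD_eq_getElem?_getD]
      rw [List.getElem?_eq_none]
      · simp
      · rw [List.length_take, min_eq_left hp]; exact not_lt.1 h

omit [CommSemiring k] in
/-- An operand referring below `n` reads only the first `n` variable sets. [folklore] -/
theorem operandVarSet_take_of_refsBelow (u : Operand k σ) (VS : List (Finset σ)) {n : ℕ}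
    (hu : u.RefsBelow n) : operandVarSet (VS.take n) u = operandVarSet VS u := by
  cases u with
  | var i => rfl
  | const c => rfl
  | gate j =>
    simp only [operandVarSet, List.getD_eq_getElem?_getD]
    rw [List.getElem?_take_of_lt hu]

/-- The syntactic variable set of a truncated operand. [folklore] -/
theorem operandVarSet_truncate (u : Operand k σ) (VS : List (Finset σ)) {p : ℕ}
    (hp : p ≤ VS.length) : operandVarSet VS (u.truncate p) = operandVarSet (VS.take p) u := by
  cases u with
  | var i => rfl
  | const c => rfl
  | gate j =>
    by_cases h : j < p
    · simp only [Operand.truncate, if_pos h, operandVarSet, List.getD_eq_getElem?_getD]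
      rw [List.getElem?_take_of_lt h]
    · simp only [Operand.truncate, if_neg h, operandVarSet, List.getD_eq_getElem?_getD]
      rw [List.getElem?_eq_none]
      · rfl
      · rw [List.length_take, min_eq_left hp]; exact not_lt.1 h

end Operands

/-! ### Gate values and gate variable sets -/

section Gates

variable {k : Type u} {σ : Type v} [CommSemiring k]

/-- `gateValues` is a `foldSnoc`. [folklore] -/
theorem gateValues_eq_foldSnoc (gs : List (Gate k σ)) :
    gateValues gs = foldSnoc (fun vals g => g.eval vals) gs := rfl

/-- The values of a prefix of the gates are a prefix of the values. [folklore] -/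
theorem gateValues_take (gs : List (Gate k σ)) {i : ℕ} (hi : i ≤ gs.length) :
    gateValues (gs.take i) = (gateValues gs).take i := by
  rw [gateValues_eq_foldSnoc, gateValues_eq_foldSnoc, foldSnoc_take _ _ hi]

/-- The values of `gs` are a prefix of the values of `gs ++ gs'`. [folklore] -/
theorem gateValues_prefix (gs gs' : List (Gate k σ)) : gateValues gs <+: gateValues (gs ++ gs') :=
  foldSnoc_prefix _ _ _

/-- **The value of gate `i`**: gate `i` evaluated against the values of the gates before it. [folklore] -/
theorem getD_gateValues (gs : List (Gate k σ)) {i : ℕ} (hi : i < gs.length) :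
    (gateValues gs).getD i 0 = (gs[i]).eval (gateValues (gs.take i)) := by
  rw [gateValues_eq_foldSnoc, gateValues_eq_foldSnoc, getD_foldSnoc _ _ hi]

variable [DecidableEq σ]

omit [CommSemiring k] in
/-- `gateVarSets` is a `foldSnoc`. [folklore] -/
theorem gateVarSets_eq_foldSnoc (gs : List (Gate k σ)) :
    gateVarSets gs = foldSnoc (fun vs g => gateVarSet vs g) gs := rfl

omit [CommSemiring k] in
/-- `gateVarSets` commutes with `take`. [folklore] -/
theorem gateVarSets_take (gs : List (Gate k σ)) {i : ℕ} (hi : i ≤ gs.length) :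
    gateVarSets (gs.take i) = (gateVarSets gs).take i := by
  rw [gateVarSets_eq_foldSnoc, gateVarSets_eq_foldSnoc, foldSnoc_take _ _ hi]

omit [CommSemiring k] in
/-- **The syntactic variable set `X_i` of gate `i`.** [cite: RazYehudayoff2008, §2] -/
theorem getD_gateVarSets (gs : List (Gate k σ)) {i : ℕ} (hi : i < gs.length) :
    (gateVarSets gs).getD i ∅ = gateVarSet (gateVarSets (gs.take i)) (gs[i]) := by
  rw [gateVarSets_eq_foldSnoc, gateVarSets_eq_foldSnoc, getD_foldSnoc _ _ hi]

omit [CommSemiring k] in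
/-- Membership in the variable set of a gate: in the variable set of one of its operands. [folklore] -/
theorem mem_gateVarSet_iff (vs : List (Finset σ)) (g : Gate k σ) (x : σ) :
    x ∈ gateVarSet vs g ↔ ∃ u ∈ g.args, x ∈ operandVarSet vs u := by
  unfold gateVarSet
  induction g.args with
  | nil => simp
  | cons u l ih =>
    simp only [List.map_cons, List.foldr_cons, Finset.mem_union, List.mem_cons]
    rw [ih]
    constructor
    · rintro (h | ⟨u', hu', h⟩)
      · exact ⟨u, Or.inl rfl, h⟩
      · exact ⟨u', Or.inr hu', h⟩
    · rintro ⟨u', rfl | hu', h⟩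
      · exact Or.inl h
      · exact Or.inr ⟨u', hu', h⟩

omit [CommSemiring k] in
/-- The variable set of an operand is contained in the variable set of its gate. [folklore] -/
theorem operandVarSet_subset_gateVarSet (vs : List (Finset σ)) (g : Gate k σ) {u : Operand k σ}
    (hu : u ∈ g.args) : operandVarSet vs u ⊆ gateVarSet vs g := fun x hx =>
  (mem_gateVarSet_iff vs g x).2 ⟨u, hu, hx⟩

omit [CommSemiring k] in
/-- **Monotonicity of the syntactic variable sets along references**: if gate `p` has the
operand `gate j`, `j < p`, then `X_j ⊆ X_p`. [cite: RazYehudayoff2008, §2] -/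
theorem gateVarSets_mono_of_mem_args (gs : List (Gate k σ)) {p j : ℕ} (hp : p < gs.length)
    (hjp : j < p) (hj : Operand.gate j ∈ (gs[p]).args) :
    (gateVarSets gs).getD j ∅ ⊆ (gateVarSets gs).getD p ∅ := by
  rw [getD_gateVarSets gs hp]
  refine subset_trans ?_ (operandVarSet_subset_gateVarSet _ _ hj)
  simp only [operandVarSet]
  rw [gateVarSets_take gs hp.le, List.getD_eq_getElem?_getD, List.getD_eq_getElem?_getD,
    List.getElem?_take_of_lt hjp]

/-- **Values live in the syntactic variable sets**: the value of gate `i` only involves the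
variables `X_i`. [cite: RazYehudayoff2008, §2] -/
theorem gateValues_mem_supported (gs : List (Gate k σ)) {i : ℕ} (hi : i < gs.length) :
    (gateValues gs).getD i 0 ∈ supported k (↑((gateVarSets gs).getD i ∅) : Set σ) := by
  induction i using Nat.strong_induction_on with
  | _ i ih =>
    rw [getD_gateValues gs hi, getD_gateVarSets gs hi]
    set vals := gateValues (gs.take i)
    set vs := gateVarSets (gs.take i)
    have hop : ∀ u : Operand k σ, u.eval vals ∈ supported k (↑(operandVarSet vs u) : Set σ) := by
      intro u
      cases u with
      | var x =>
        simp only [Operand.eval, operandVarSet, Finset.coe_singleton]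
        exact Algebra.subset_adjoin (Set.mem_image_of_mem _ (Set.mem_singleton x))
      | const c =>
        simp only [Operand.eval, operandVarSet]
        exact Subalgebra.algebraMap_mem _ c
      | gate j =>
        simp only [Operand.eval_gate, operandVarSet, vals, vs]
        by_cases hj : j < i
        · rw [gateValues_take gs hi.le, gateVarSets_take gs hi.le, List.getD_eq_getElem?_getD,
            List.getD_eq_getElem?_getD, List.getElem?_take_of_lt hj, List.getElem?_take_of_lt hj,
            ← List.getD_eq_getElem?_getD, ← List.getD_eq_getElem?_getD]
          exact ih j hj (hj.trans hi)
        · have h1 : (gateValues (gs.take i)).getD j 0 = 0 := by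
            apply List.getD_eq_default _ _
            rw [gateValues_length, List.length_take, min_eq_left hi.le]
            exact not_lt.1 hj
          rw [h1]
          exact Subalgebra.zero_mem _
    have hop' : ∀ u ∈ (gs[i]).args,
        u.eval vals ∈ supported k (↑(gateVarSet vs (gs[i])) : Set σ) := fun u hu =>
      supported_mono (Finset.coe_subset.2 (operandVarSet_subset_gateVarSet vs _ hu)) (hop u)
    generalize gs[i] = g at hop' ⊢
    cases g with
    | sum args =>
      simp only [Gate.eval]
      apply Subalgebra.list_sum_mem
      intro f hf
      obtain ⟨a, ha, rfl⟩ := List.mem_map.1 hf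
      exact Subalgebra.smul_mem _ (hop' a.2 (List.mem_map.2 ⟨a, ha, rfl⟩)) a.1
    | prod args =>
      simp only [Gate.eval]
      apply Subalgebra.list_prod_mem
      intro f hf
      obtain ⟨u, hu, rfl⟩ := List.mem_map.1 hf
      exact hop' u hu

end Gates


/-! ### The Baur–Strassen derivative construction -/

section BS

variable {k : Type u} {σ : Type v}

/-- The partial derivative of a gate with respect to one of its operand slots is either a
scalar (weighted-sum gates) or the other operand (product gates). [cite: AlonKumarVolk2020, Thm. 21] -/
inductive Weight (k : Type u) (σ : Type v) : Type max u v
  /-- scalar weight `c` (slot `c • u` of a sum gate, or the single slot of `prod [u]`) -/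
  | coef (c : k) : Weight k σ
  /-- the other operand `w` of a product gate `u * w` -/
  | opnd (w : Operand k σ) : Weight k σ

/-- Scoping of a weight. [folklore] -/
def Weight.RefsBelow (n : ℕ) : Weight k σ → Prop
  | .coef _ => True
  | .opnd w => w.RefsBelow n

/-- Monotonicity of `Weight.RefsBelow`. [folklore] -/
theorem Weight.refsBelow_mono {wt : Weight k σ} {n m : ℕ} (h : wt.RefsBelow n) (hnm : n ≤ m) :
    wt.RefsBelow m := by
  cases wt with
  | coef c => trivial
  | opnd w => exact AKV.refsBelow_mono h hnm

variable [CommSemiring k] [DecidableEq σ]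

/-- The operands in the two slots of a fan-in-two gate sitting at index `p` (junk references
truncated at `p`; missing slots are the constant `0`). [cite: AlonKumarVolk2020, Thm. 21] -/
def slotOp (g : Gate k σ) (p : ℕ) : Fin 2 → Operand k σ :=
  match g with
  | .sum [a] => ![a.2.truncate p, .const 0]
  | .sum [a, b] => ![a.2.truncate p, b.2.truncate p]
  | .prod [u] => ![u.truncate p, .const 0]
  | .prod [u, w] => ![u.truncate p, w.truncate p]
  | _ => ![.const 0, .const 0]

/-- The weights (slot derivatives) of the two slots of a fan-in-two gate at index `p`. [cite: AlonKumarVolk2020, Thm. 21] -/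
def slotWt (g : Gate k σ) (p : ℕ) : Fin 2 → Weight k σ :=
  match g with
  | .sum [a] => ![.coef a.1, .coef 0]
  | .sum [a, b] => ![.coef a.1, .coef b.1]
  | .prod [_] => ![.coef 1, .coef 0]
  | .prod [u, w] => ![.opnd (w.truncate p), .opnd (u.truncate p)]
  | _ => ![.coef 0, .coef 0]

omit [DecidableEq σ] in
/-- Slot operands refer below the gate's own index. [folklore] -/
theorem slotOp_refsBelow (g : Gate k σ) (p : ℕ) (i : Fin 2) : (slotOp g p i).RefsBelow p := by
  have h0 : (Operand.const 0 : Operand k σ).RefsBelow p := trivial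
  rcases g with args | args
  · rcases args with _ | ⟨a, _ | ⟨b, _ | ⟨c, l⟩⟩⟩ <;>
      fin_cases i <;> simp [slotOp, h0, refsBelow_truncate]
  · rcases args with _ | ⟨a, _ | ⟨b, _ | ⟨c, l⟩⟩⟩ <;>
      fin_cases i <;> simp [slotOp, h0, refsBelow_truncate]

omit [DecidableEq σ] in
/-- Slot weights refer below the gate's own index. [folklore] -/
theorem slotWt_refsBelow (g : Gate k σ) (p : ℕ) (i : Fin 2) : (slotWt g p i).RefsBelow p := by
  rcases g with args | args
  · rcases args with _ | ⟨a, _ | ⟨b, _ | ⟨c, l⟩⟩⟩ <;>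
      fin_cases i <;> simp [slotWt, Weight.RefsBelow]
  · rcases args with _ | ⟨a, _ | ⟨b, _ | ⟨c, l⟩⟩⟩ <;>
      fin_cases i <;> simp [slotWt, Weight.RefsBelow, refsBelow_truncate]

/-- State of the reverse sweep: the new gates built so far (to be appended after the original
gates, absolute indexing) and the current adjoint accumulator operand of every original gate
(`acc`) and of every variable (`dacc`). [cite: AlonKumarVolk2020, Thm. 21] -/
structure BSState (k : Type u) (σ : Type v) : Type max u v where
  /-- the new gates -/
  extra : List (Gate k σ)
  /-- `acc j` computes the adjoint `∂f/∂v_j` accumulated so far -/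
  acc : ℕ → Operand k σ
  /-- `dacc x` computes the derivative `∂f/∂x` accumulated so far -/
  dacc : σ → Operand k σ

/-- The gates realising `old + a · wt` and the operand holding the result: one weighted sum
gate for a scalar weight, a product gate followed by a sum gate for an operand weight. The new
gates get the absolute indices `s + |E|, s + |E| + 1`. [cite: AlonKumarVolk2020, Thm. 21] -/
def mkGates (s : ℕ) (E : List (Gate k σ)) (old a : Operand k σ) :
    Weight k σ → List (Gate k σ) × Operand k σ
  | .coef c => ([.sum [(1, old), (c, a)]], .gate (s + E.length))
  | .opnd w => ([.prod [a, w], .sum [(1, old), (1, .gate (s + E.length))]], .gate (s + E.length + 1))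

/-- Push the contribution `a · wt` of one slot (holding the operand `u`) into the accumulator of
`u`'s target (a gate or a variable; constants absorb nothing). [cite: AlonKumarVolk2020, Thm. 21] -/
def push (s : ℕ) (st : BSState k σ) (a u : Operand k σ) (wt : Weight k σ) : BSState k σ :=
  match u with
  | .const _ => st
  | .gate j =>
    { extra := st.extra ++ (mkGates s st.extra (st.acc j) a wt).1
      acc := Function.update st.acc j (mkGates s st.extra (st.acc j) a wt).2
      dacc := st.dacc }
  | .var x =>
    { extra := st.extra ++ (mkGates s st.extra (st.dacc x) a wt).1
      acc := st.acc
      dacc := Function.update st.dacc x (mkGates s st.extra (st.dacc x) a wt).2 }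

/-- Process the original gate `p`: push both of its slots with the (final) adjoint operand
`acc p`. [cite: AlonKumarVolk2020, Thm. 21] -/
def step (gs : List (Gate k σ)) (st : BSState k σ) (p : ℕ) : BSState k σ :=
  match gs[p]? with
  | none => st
  | some g =>
    push gs.length (push gs.length st (st.acc p) (slotOp g p 0) (slotWt g p 0)) (st.acc p)
      (slotOp g p 1) (slotWt g p 1)

/-- The reverse sweep: `run gs r` is the state after processing the gates
`s - 1, s - 2, …, s - r` (`s = |gs|`); initially the adjoint of the output gate `s - 1` is `1`
and all other accumulators are `0`. [cite: AlonKumarVolk2020, Thm. 21] -/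
def run (gs : List (Gate k σ)) : ℕ → BSState k σ
  | 0 => { extra := []
           acc := fun j => if j + 1 = gs.length then .const 1 else .const 0
           dacc := fun _ => .const 0 }
  | r + 1 => step gs (run gs r) (gs.length - 1 - r)

/-- The final state of the sweep. [cite: AlonKumarVolk2020, Thm. 21] -/
def bsFinal (gs : List (Gate k σ)) : BSState k σ := run gs gs.length

/-- **The Baur–Strassen derivative gate list**: the original gates followed by the new ones. [cite: AlonKumarVolk2020, Thm. 21] -/
def derivGates (gs : List (Gate k σ)) : List (Gate k σ) := gs ++ (bsFinal gs).extra

/-- The operand computing `∂f/∂x` in `derivGates gs`. [cite: AlonKumarVolk2020, Thm. 21] -/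
def derivOut (gs : List (Gate k σ)) (x : σ) : Operand k σ := (bsFinal gs).dacc x

/-! #### Structural facts: prefixes, size, scoping -/

omit [DecidableEq σ] in
/-- `mkGates` makes at most two gates. [folklore] -/
theorem mkGates_length_le (s : ℕ) (E : List (Gate k σ)) (old a : Operand k σ) (wt : Weight k σ) :
    (mkGates s E old a wt).1.length ≤ 2 := by
  cases wt <;> simp [mkGates]

/-- `push` only appends gates. [folklore] -/
theorem push_extra_prefix (s : ℕ) (st : BSState k σ) (a u : Operand k σ) (wt : Weight k σ) :
    st.extra <+: (push s st a u wt).extra := by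
  cases u <;> simp [push]

/-- `push` adds at most two gates. [folklore] -/
theorem push_extra_length_le (s : ℕ) (st : BSState k σ) (a u : Operand k σ) (wt : Weight k σ) :
    (push s st a u wt).extra.length ≤ st.extra.length + 2 := by
  cases u with
  | const c => simp [push]
  | var x => simpa [push] using mkGates_length_le s st.extra (st.dacc x) a wt
  | gate j => simpa [push] using mkGates_length_le s st.extra (st.acc j) a wt

/-- `step` only appends gates. [folklore] -/
theorem step_extra_prefix (gs : List (Gate k σ)) (st : BSState k σ) (p : ℕ) :
    st.extra <+: (step gs st p).extra := by
  unfold step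
  cases gs[p]? with
  | none => exact List.prefix_rfl
  | some g => exact (push_extra_prefix _ _ _ _ _).trans (push_extra_prefix _ _ _ _ _)

/-- `step` adds at most four gates. [folklore] -/
theorem step_extra_length_le (gs : List (Gate k σ)) (st : BSState k σ) (p : ℕ) :
    (step gs st p).extra.length ≤ st.extra.length + 4 := by
  unfold step
  cases gs[p]? with
  | none => simp
  | some g =>
    exact (push_extra_length_le _ _ _ _ _).trans
      (by have := push_extra_length_le gs.length st (st.acc p) (slotOp g p 0) (slotWt g p 0); omega)

/-- The sweep only appends gates. [folklore] -/
theorem run_extra_prefix (gs : List (Gate k σ)) {r r' : ℕ} (h : r ≤ r') :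
    (run gs r).extra <+: (run gs r').extra := by
  induction h with
  | refl => exact List.prefix_rfl
  | step _ ih => exact ih.trans (step_extra_prefix _ _ _)

/-- **Size**: after `r` steps at most `4r` new gates. [cite: AlonKumarVolk2020, Thm. 21 (2)] -/
theorem run_extra_length_le (gs : List (Gate k σ)) (r : ℕ) : (run gs r).extra.length ≤ 4 * r := by
  induction r with
  | zero => simp [run]
  | succ r ih => exact (step_extra_length_le _ _ _).trans (by omega)

/-- **|Ψ'| ≤ 5|Ψ|.** [cite: AlonKumarVolk2020, Thm. 21 (2)] -/
theorem derivGates_length_le (gs : List (Gate k σ)) : (derivGates gs).length ≤ 5 * gs.length := by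
  unfold derivGates bsFinal
  rw [List.length_append]
  have := run_extra_length_le gs gs.length
  omega

/-- Scoping invariant of a state: accumulators refer below the current end of the gate list, and
every new gate only refers to gates before it. [folklore] -/
def BSState.WellScoped (s : ℕ) (st : BSState k σ) : Prop :=
  (∀ j, (st.acc j).RefsBelow (s + st.extra.length)) ∧
    (∀ x, (st.dacc x).RefsBelow (s + st.extra.length)) ∧
    (∀ t (ht : t < st.extra.length), ∀ u ∈ (st.extra[t]).args, u.RefsBelow (s + t))

omit [DecidableEq σ] in
/-- The gates made by `mkGates` are well scoped and the result operand refers below the new end.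
[folklore] -/
theorem mkGates_scoped (s : ℕ) (E : List (Gate k σ)) {old a : Operand k σ} {wt : Weight k σ}
    (hold : old.RefsBelow (s + E.length)) (ha : a.RefsBelow (s + E.length))
    (hwt : wt.RefsBelow (s + E.length)) :
    (∀ t (ht : t < (mkGates s E old a wt).1.length),
        ∀ u ∈ ((mkGates s E old a wt).1[t]).args, u.RefsBelow (s + E.length + t)) ∧
      (mkGates s E old a wt).2.RefsBelow (s + E.length + (mkGates s E old a wt).1.length) := by
  cases wt with
  | coef c =>
    refine ⟨?_, by simp [mkGates, Operand.RefsBelow]⟩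
    intro t ht u hu
    simp only [mkGates, List.length_singleton] at ht
    have ht0 : t = 0 := by omega
    subst ht0
    simp only [mkGates, List.getElem_cons_zero, Gate.args, List.map_cons, List.map_nil,
      List.mem_cons, List.not_mem_nil, or_false] at hu
    rcases hu with rfl | rfl
    · simpa using hold
    · simpa using ha
  | opnd w =>
    refine ⟨?_, by simp [mkGates, Operand.RefsBelow]⟩
    intro t ht u hu
    simp only [mkGates, List.length_cons, List.length_nil] at ht
    rcases (show t = 0 ∨ t = 1 by omega) with rfl | rfl
    · simp only [mkGates, List.getElem_cons_zero, Gate.args, List.mem_cons, List.not_mem_nil,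
        or_false] at hu
      rcases hu with rfl | rfl
      · simpa using ha
      · simpa [Weight.RefsBelow] using hwt
    · simp only [mkGates, List.getElem_cons_succ, List.getElem_cons_zero, Gate.args,
        List.map_cons, List.map_nil, List.mem_cons, List.not_mem_nil, or_false] at hu
      rcases hu with rfl | rfl
      · exact refsBelow_mono hold (by omega)
      · show s + E.length < s + E.length + 1
        omega

/-- `push` preserves the scoping invariant. [folklore] -/
theorem push_wellScoped {s : ℕ} {st : BSState k σ} (hst : st.WellScoped s) {a u : Operand k σ}
    {wt : Weight k σ} (ha : a.RefsBelow (s + st.extra.length))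
    (hwt : wt.RefsBelow (s + st.extra.length)) : (push s st a u wt).WellScoped s := by
  obtain ⟨h1, h2, h3⟩ := hst
  cases u with
  | const c => exact ⟨h1, h2, h3⟩
  | gate j =>
    obtain ⟨m1, m2⟩ := mkGates_scoped s st.extra (h1 j) ha hwt
    refine ⟨fun j' => ?_, fun x => ?_, fun t ht u hu => ?_⟩
    · simp only [push, List.length_append]
      by_cases hj : j' = j
      · subst hj
        rw [Function.update_self, ← Nat.add_assoc]
        exact m2
      · rw [Function.update_of_ne hj]
        exact refsBelow_mono (h1 j') (by omega)
    · simp only [push, List.length_append]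
      exact refsBelow_mono (h2 x) (by omega)
    · simp only [push, List.length_append] at ht hu ⊢
      by_cases hlt : t < st.extra.length
      · rw [List.getElem_append_left hlt] at hu
        exact h3 t hlt u hu
      · push Not at hlt
        rw [List.getElem_append_right hlt] at hu
        have := m1 (t - st.extra.length) (by omega) u hu
        rwa [show s + st.extra.length + (t - st.extra.length) = s + t by omega] at this
  | var x =>
    obtain ⟨m1, m2⟩ := mkGates_scoped s st.extra (h2 x) ha hwt
    refine ⟨fun j' => ?_, fun x' => ?_, fun t ht u hu => ?_⟩
    · simp only [push, List.length_append]
      exact refsBelow_mono (h1 j') (by omega)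
    · simp only [push, List.length_append]
      by_cases hx : x' = x
      · subst hx
        rw [Function.update_self, ← Nat.add_assoc]
        exact m2
      · rw [Function.update_of_ne hx]
        exact refsBelow_mono (h2 x') (by omega)
    · simp only [push, List.length_append] at ht hu ⊢
      by_cases hlt : t < st.extra.length
      · rw [List.getElem_append_left hlt] at hu
        exact h3 t hlt u hu
      · push Not at hlt
        rw [List.getElem_append_right hlt] at hu
        have := m1 (t - st.extra.length) (by omega) u hu
        rwa [show s + st.extra.length + (t - st.extra.length) = s + t by omega] at this

/-- `step` preserves the scoping invariant (the original gates sit below `s`). [folklore] -/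
theorem step_wellScoped {gs : List (Gate k σ)} {st : BSState k σ} (hst : st.WellScoped gs.length)
    (p : ℕ) (hp : p < gs.length) : (step gs st p).WellScoped gs.length := by
  unfold step
  cases hg : gs[p]? with
  | none => exact hst
  | some g =>
    simp only
    have ha : (st.acc p).RefsBelow (gs.length + st.extra.length) := hst.1 p
    have hst1 := push_wellScoped hst (u := slotOp g p 0) ha
      (Weight.refsBelow_mono (slotWt_refsBelow g p 0) (by omega))
    refine push_wellScoped hst1 ?_ (Weight.refsBelow_mono (slotWt_refsBelow g p 1) (by omega))
    have hle := (push_extra_prefix gs.length st (st.acc p) (slotOp g p 0) (slotWt g p 0)).length_le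
    exact refsBelow_mono ha (by omega)

/-- The sweep is well scoped. [folklore] -/
theorem run_wellScoped (gs : List (Gate k σ)) (r : ℕ) : (run gs r).WellScoped gs.length := by
  induction r with
  | zero =>
    refine ⟨fun j => ?_, fun x => trivial, fun t ht => ?_⟩
    · simp only [run]
      split_ifs <;> trivial
    · simp [run] at ht
  | succ r ih =>
    simp only [run]
    by_cases hs : gs.length = 0
    · have : gs = [] := List.eq_nil_of_length_eq_zero hs
      subst this
      simp [step]
      exact ih
    · exact step_wellScoped ih _ (by omega)

end BS


/-! ### Semantics of the sweep -/

section Semantics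

variable {k : Type u} {σ : Type v} [CommSemiring k] [DecidableEq σ]

/-- The value of a weight against a value list. [folklore] -/
def wval (V : List (MvPolynomial σ k)) : Weight k σ → MvPolynomial σ k
  | .coef c => C c
  | .opnd w => w.eval V

omit [DecidableEq σ] in
/-- A weight referring below `n` reads only the first `n` values. [folklore] -/
theorem wval_take_of_refsBelow (V : List (MvPolynomial σ k)) {wt : Weight k σ} {n : ℕ}
    (h : wt.RefsBelow n) : wval (V.take n) wt = wval V wt := by
  cases wt with
  | coef c => rfl
  | opnd w => exact eval_take_of_refsBelow w V h

/-- Consistency of a value list `V` with gates `Efin` placed at the absolute offset `s`: the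
value at `s + t` is gate `t` evaluated against the earlier values. [folklore] -/
def ValCons (V : List (MvPolynomial σ k)) (s : ℕ) (Efin : List (Gate k σ)) : Prop :=
  ∀ t g, Efin[t]? = some g → V.getD (s + t) 0 = g.eval (V.take (s + t))

omit [DecidableEq σ] in
/-- Entries of a list inside a prefix. [folklore] -/
theorem getElem?_of_prefix {α : Type*} {l₁ l₂ : List α} (h : l₁ <+: l₂) {i : ℕ} (hi : i < l₁.length) :
    l₂[i]? = l₁[i]? := by
  obtain ⟨t, rfl⟩ := h
  exact List.getElem?_append_left hi

omit [DecidableEq σ] in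
/-- **Semantics of `mkGates`**: the result operand computes `old + a · wt`. [cite: AlonKumarVolk2020, Thm. 21] -/
theorem mkGates_eval {s : ℕ} {E Efin : List (Gate k σ)} {old a : Operand k σ} {wt : Weight k σ}
    (V : List (MvPolynomial σ k)) (hpre : E ++ (mkGates s E old a wt).1 <+: Efin)
    (hV : ValCons V s Efin) (hold : old.RefsBelow (s + E.length)) (ha : a.RefsBelow (s + E.length))
    (hwt : wt.RefsBelow (s + E.length)) :
    (mkGates s E old a wt).2.eval V = old.eval V + a.eval V * wval V wt := by
  cases wt with
  | coef c =>
    have h0 : Efin[E.length]? = some (.sum [(1, old), (c, a)]) := by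
      rw [getElem?_of_prefix hpre (by simp [mkGates])]
      simp [mkGates]
    simp only [mkGates, Operand.eval_gate]
    rw [hV _ _ h0]
    simp only [Gate.eval, List.map_cons, List.map_nil, List.sum_cons, List.sum_nil, add_zero, one_smul]
    rw [eval_take_of_refsBelow old V hold, eval_take_of_refsBelow a V ha, smul_eq_C_mul, wval, mul_comm]
  | opnd w =>
    have h0 : Efin[E.length]? = some (.prod [a, w]) := by
      rw [getElem?_of_prefix hpre (by simp [mkGates])]
      simp [mkGates]
    have h1 : Efin[E.length + 1]? = some (.sum [(1, old), (1, .gate (s + E.length))]) := by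
      rw [getElem?_of_prefix hpre (by simp [mkGates])]
      simp [mkGates]
    simp only [mkGates, Operand.eval_gate]
    rw [show s + E.length + 1 = s + (E.length + 1) by omega, hV _ _ h1]
    simp only [Gate.eval, List.map_cons, List.map_nil, List.sum_cons, List.sum_nil, add_zero, one_smul]
    rw [eval_take_of_refsBelow old V (refsBelow_mono hold (by omega)),
      eval_take_of_refsBelow (Operand.gate (s + E.length)) V (by simp), Operand.eval_gate, hV _ _ h0]
    simp only [Gate.eval, List.map_cons, List.map_nil, List.prod_cons, List.prod_nil, mul_one]
    rw [eval_take_of_refsBelow a V ha, eval_take_of_refsBelow w V hwt]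
    rfl

/-- `gateInd u j w = w` if the operand `u` is `gate j`, else `0`. [folklore] -/
def gateInd {M : Type*} [Zero M] (u : Operand k σ) (j : ℕ) (w : M) : M :=
  match u with
  | .gate j' => if j' = j then w else 0
  | _ => 0

/-- `varInd u x w = w` if the operand `u` is the variable `x`, else `0`. [folklore] -/
def varInd {M : Type*} [Zero M] (u : Operand k σ) (x : σ) (w : M) : M :=
  match u with
  | .var y => if y = x then w else 0
  | _ => 0

/-- **Semantics of `push`.** [cite: AlonKumarVolk2020, Thm. 21] -/
theorem push_eval {s : ℕ} {st : BSState k σ} {a u : Operand k σ} {wt : Weight k σ}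
    (V : List (MvPolynomial σ k)) {Efin : List (Gate k σ)} (hpre : (push s st a u wt).extra <+: Efin)
    (hV : ValCons V s Efin) (hst : st.WellScoped s) (ha : a.RefsBelow (s + st.extra.length))
    (hwt : wt.RefsBelow (s + st.extra.length)) :
    (∀ j, ((push s st a u wt).acc j).eval V =
        (st.acc j).eval V + gateInd u j (a.eval V * wval V wt)) ∧
      (∀ x, ((push s st a u wt).dacc x).eval V =
        (st.dacc x).eval V + varInd u x (a.eval V * wval V wt)) := by
  cases u with
  | const c => exact ⟨fun j => by simp [push, gateInd], fun x => by simp [push, varInd]⟩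
  | gate j =>
    refine ⟨fun j' => ?_, fun x => by simp [push, varInd]⟩
    simp only [push, gateInd]
    by_cases hj : j' = j
    · subst hj
      rw [Function.update_self, if_pos rfl]
      exact mkGates_eval V (by simpa [push] using hpre) hV (hst.1 j') ha hwt
    · rw [Function.update_of_ne hj, if_neg (Ne.symm hj), add_zero]
  | var x =>
    refine ⟨fun j => by simp [push, gateInd], fun x' => ?_⟩
    simp only [push, varInd]
    by_cases hx : x' = x
    · subst hx
      rw [Function.update_self, if_pos rfl]
      exact mkGates_eval V (by simpa [push] using hpre) hV (hst.2.1 x') ha hwt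
    · rw [Function.update_of_ne hx, if_neg (Ne.symm hx), add_zero]

/-- `M(p, j)`: the total weight of the slots of gate `p` holding `gate j`. [cite: AlonKumarVolk2020, Thm. 21] -/
def Mw (V : List (MvPolynomial σ k)) (gs : List (Gate k σ)) (p j : ℕ) : MvPolynomial σ k :=
  ∑ i : Fin 2, gateInd (slotOp (gs.getD p (.prod [])) p i) j (wval V (slotWt (gs.getD p (.prod [])) p i))

/-- `b(p, x)`: the total weight of the slots of gate `p` holding the variable `x`. [cite: AlonKumarVolk2020, Thm. 21] -/
def bw (V : List (MvPolynomial σ k)) (gs : List (Gate k σ)) (p : ℕ) (x : σ) : MvPolynomial σ k :=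
  ∑ i : Fin 2, varInd (slotOp (gs.getD p (.prod [])) p i) x (wval V (slotWt (gs.getD p (.prod [])) p i))

omit [DecidableEq σ] in
/-- The slots of gate `p` never hold `gate j` for `j ≥ p`. [folklore] -/
theorem Mw_eq_zero_of_le (V : List (MvPolynomial σ k)) (gs : List (Gate k σ)) {p j : ℕ} (h : p ≤ j) :
    Mw V gs p j = 0 := by
  unfold Mw
  refine Finset.sum_eq_zero fun i _ => ?_
  have := slotOp_refsBelow (gs.getD p (.prod [])) p i
  generalize slotOp (gs.getD p (.prod [])) p i = u at this ⊢
  cases u with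
  | var y => rfl
  | const c => rfl
  | gate j' =>
    rw [refsBelow_gate_iff] at this
    exact if_neg (by omega)

/-- `step` at a genuine gate index. [folklore] -/
theorem step_eq_of_lt (gs : List (Gate k σ)) (st : BSState k σ) {p : ℕ} (hp : p < gs.length) :
    step gs st p = push gs.length (push gs.length st (st.acc p) (slotOp gs[p] p 0) (slotWt gs[p] p 0))
      (st.acc p) (slotOp gs[p] p 1) (slotWt gs[p] p 1) := by
  unfold step
  rw [List.getElem?_eq_getElem hp]

/-- **Semantics of `step`**: processing gate `p` adds `acc p · M(p, j)` to `acc j` and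
`acc p · b(p, x)` to `dacc x`. [cite: AlonKumarVolk2020, Thm. 21] -/
theorem step_eval {gs : List (Gate k σ)} {st : BSState k σ} {p : ℕ} (hp : p < gs.length)
    (V : List (MvPolynomial σ k)) {Efin : List (Gate k σ)} (hpre : (step gs st p).extra <+: Efin)
    (hV : ValCons V gs.length Efin) (hst : st.WellScoped gs.length) :
    (∀ j, ((step gs st p).acc j).eval V = (st.acc j).eval V + (st.acc p).eval V * Mw V gs p j) ∧
      (∀ x, ((step gs st p).dacc x).eval V = (st.dacc x).eval V + (st.acc p).eval V * bw V gs p x) := by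
  have hg : gs.getD p (.prod []) = gs[p] := by
    rw [List.getD_eq_getElem?_getD, List.getElem?_eq_getElem hp, Option.getD_some]
  rw [step_eq_of_lt gs st hp] at hpre ⊢
  set g := gs[p]
  set st₁ := push gs.length st (st.acc p) (slotOp g p 0) (slotWt g p 0) with hst₁
  have ha : (st.acc p).RefsBelow (gs.length + st.extra.length) := hst.1 p
  have hst₁ws : st₁.WellScoped gs.length :=
    push_wellScoped hst ha (Weight.refsBelow_mono (slotWt_refsBelow g p 0) (by omega))
  have hpre₁ : st₁.extra <+: Efin := (push_extra_prefix _ _ _ _ _).trans hpre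
  have hlen₁ : st.extra.length ≤ st₁.extra.length := (push_extra_prefix _ _ _ _ _).length_le
  obtain ⟨e1a, e1d⟩ := push_eval V hpre₁ hV hst ha
    (Weight.refsBelow_mono (slotWt_refsBelow g p 0) (by omega))
  obtain ⟨e2a, e2d⟩ := push_eval V hpre hV hst₁ws (refsBelow_mono ha (by omega))
    (Weight.refsBelow_mono (slotWt_refsBelow g p 1) (by omega))
  have hgi : ∀ (u : Operand k σ) (j : ℕ) (w : MvPolynomial σ k),
      (st.acc p).eval V * gateInd u j w = gateInd u j ((st.acc p).eval V * w) := by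
    intro u j w
    cases u <;> simp [gateInd, mul_ite]
  have hvi : ∀ (u : Operand k σ) (x : σ) (w : MvPolynomial σ k),
      (st.acc p).eval V * varInd u x w = varInd u x ((st.acc p).eval V * w) := by
    intro u x w
    cases u <;> simp [varInd, mul_ite]
  refine ⟨fun j => ?_, fun x => ?_⟩
  · rw [e2a j, e1a j, Mw, hg, Fin.sum_univ_two, mul_add, hgi, hgi, add_assoc]
  · rw [e2d x, e1d x, bw, hg, Fin.sum_univ_two, mul_add, hvi, hvi, add_assoc]

/-- The value list of the derivative gate list and its consistency. [folklore] -/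
theorem valCons_derivGates (gs : List (Gate k σ)) :
    ValCons (gateValues (derivGates gs)) gs.length (bsFinal gs).extra := by
  intro t g hg
  have ht : t < (bsFinal gs).extra.length := (List.getElem?_eq_some_iff.1 hg).1
  have hlt : gs.length + t < (derivGates gs).length := by
    simp only [derivGates, List.length_append]; omega
  rw [getD_gateValues _ hlt, gateValues_take _ hlt.le]
  congr 1
  simp only [derivGates]
  rw [List.getElem_append_right (by omega)]
  have := (List.getElem?_eq_some_iff.1 hg).2
  simp only [Nat.add_sub_cancel_left]
  exact this

/-- **The invariant of the sweep.** After `r` steps, `acc j` holds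
`e_j + ∑_{p ≥ max(j+1, s-r)} acc p · M(p, j)` and `dacc x` holds `∑_{p ≥ s-r} acc p · b(p, x)`
(all read in the final value list). [cite: AlonKumarVolk2020, Thm. 21] -/
theorem run_eval (gs : List (Gate k σ)) {r : ℕ} (hr : r ≤ gs.length) :
    (∀ j, ((run gs r).acc j).eval (gateValues (derivGates gs)) =
        (if j + 1 = gs.length then 1 else 0) +
          ∑ p ∈ Finset.Ico (max (j + 1) (gs.length - r)) gs.length,
            ((run gs r).acc p).eval (gateValues (derivGates gs)) *
              Mw (gateValues (derivGates gs)) gs p j) ∧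
      (∀ x, ((run gs r).dacc x).eval (gateValues (derivGates gs)) =
        ∑ p ∈ Finset.Ico (gs.length - r) gs.length,
          ((run gs r).acc p).eval (gateValues (derivGates gs)) *
            bw (gateValues (derivGates gs)) gs p x) := by
  set V := gateValues (derivGates gs) with hVdef
  set s := gs.length with hsdef
  induction r with
  | zero =>
    refine ⟨fun j => ?_, fun x => ?_⟩
    · have he : Finset.Ico (max (j + 1) (s - 0)) s = ∅ := by
        rw [Finset.Ico_eq_empty_iff]; omega
      rw [he, Finset.sum_empty, add_zero]
      simp only [run]
      split_ifs <;> simp [Operand.eval]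
    · have he : Finset.Ico (s - 0) s = ∅ := by
        rw [Finset.Ico_eq_empty_iff]; omega
      rw [he, Finset.sum_empty]
      simp [run, Operand.eval]
  | succ r ih =>
    obtain ⟨iha, ihd⟩ := ih (by omega)
    set pstar := s - 1 - r with hpstar
    have hps : pstar < s := by omega
    have hsr : s - r = pstar + 1 := by omega
    have hrun : run gs (r + 1) = step gs (run gs r) pstar := rfl
    have hpre : (step gs (run gs r) pstar).extra <+: (bsFinal gs).extra := by
      rw [← hrun]; exact run_extra_prefix gs (by omega : r + 1 ≤ gs.length)
    obtain ⟨sa, sd⟩ := step_eval hps V hpre (valCons_derivGates gs) (run_wellScoped gs r)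
    -- `acc p` is unchanged for `p ≥ pstar`
    have hfix : ∀ p, pstar ≤ p → ((run gs (r + 1)).acc p).eval V = ((run gs r).acc p).eval V := by
      intro p hp
      rw [hrun, sa p, Mw_eq_zero_of_le _ _ hp, mul_zero, add_zero]
    refine ⟨fun j => ?_, fun x => ?_⟩
    · rw [hrun, sa j, iha j]
      rw [show s - (r + 1) = pstar by omega, hsr]
      by_cases hj : j < pstar
      · rw [show max (j + 1) pstar = pstar by omega, show max (j + 1) (pstar + 1) = pstar + 1 by omega,
          ← Finset.insert_Ico_add_one_left_eq_Ico hps, Finset.sum_insert (by simp), add_assoc,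
          add_comm (∑ p ∈ _, _)]
        congr 1
        congr 1
        · rw [← hrun, hfix pstar le_rfl]
        · refine Finset.sum_congr rfl fun p hpm => ?_
          rw [Finset.mem_Ico] at hpm
          rw [← hrun, hfix p (by omega)]
      · rw [show max (j + 1) pstar = j + 1 by omega, show max (j + 1) (pstar + 1) = j + 1 by omega,
          Mw_eq_zero_of_le _ _ (by omega : pstar ≤ j), mul_zero, add_zero]
        congr 1
        refine Finset.sum_congr rfl fun p hpm => ?_
        rw [Finset.mem_Ico] at hpm
        rw [← hrun, hfix p (by omega)]
    · rw [hrun, sd x, ihd x]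
      rw [show s - (r + 1) = pstar by omega, hsr, ← Finset.insert_Ico_add_one_left_eq_Ico hps,
        Finset.sum_insert (by simp), add_comm]
      congr 1
      · rw [← hrun, hfix pstar le_rfl]
      · refine Finset.sum_congr rfl fun p hpm => ?_
        rw [Finset.mem_Ico] at hpm
        rw [← hrun, hfix p (by omega)]

/-- **The adjoint recurrence** satisfied by the final accumulators `ā_j`:
`ā_j = [j = s-1] + ∑_{p > j} ā_p M(p, j)`. [cite: AlonKumarVolk2020, Thm. 21] -/
theorem adjoint_recurrence (gs : List (Gate k σ)) (j : ℕ) :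
    ((bsFinal gs).acc j).eval (gateValues (derivGates gs)) =
      (if j + 1 = gs.length then 1 else 0) +
        ∑ p ∈ Finset.Ico (j + 1) gs.length,
          ((bsFinal gs).acc p).eval (gateValues (derivGates gs)) *
            Mw (gateValues (derivGates gs)) gs p j := by
  have := (run_eval gs le_rfl).1 j
  simp only [Nat.sub_self] at this
  rw [show max (j + 1) 0 = j + 1 by omega] at this
  exact this

/-- **The output accumulators**: `dacc x = ∑_p ā_p b(p, x)`. [cite: AlonKumarVolk2020, Thm. 21] -/
theorem derivOut_eq_sum (gs : List (Gate k σ)) (x : σ) :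
    (derivOut gs x).eval (gateValues (derivGates gs)) =
      ∑ p ∈ Finset.range gs.length,
        ((bsFinal gs).acc p).eval (gateValues (derivGates gs)) *
          bw (gateValues (derivGates gs)) gs p x := by
  have := (run_eval gs le_rfl).2 x
  simp only [Nat.sub_self] at this
  rw [Finset.range_eq_Ico]
  exact this

end Semantics


/-! ### Forward tangents and the duality argument -/

section Tangents

variable {k : Type u} {σ : Type v} [CommSemiring k] [DecidableEq σ]

omit [DecidableEq σ] in
/-- **The chain rule at one gate** (fan-in two): the derivative of the value of a gate is the
sum over its two slots of `weight × derivative of the slot operand`. [cite: AlonKumarVolk2020, Thm. 21] -/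
theorem pderiv_gate_eval (g : Gate k σ) (hg : g.fanIn ≤ 2) (V : List (MvPolynomial σ k)) {p : ℕ}
    (hp : p ≤ V.length) (x : σ) :
    pderiv x (g.eval (V.take p)) =
      ∑ i : Fin 2, wval V (slotWt g p i) * pderiv x ((slotOp g p i).eval V) := by
  have htr : ∀ u : Operand k σ, (u.truncate p).eval V = u.eval (V.take p) := fun u =>
    eval_truncate_eq_eval_take u V hp
  have hc0 : (Operand.const 0 : Operand k σ).eval V = 0 := by simp [Operand.eval]
  rcases g with args | args
  · rcases args with _ | ⟨a, _ | ⟨b, _ | ⟨c, l⟩⟩⟩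
    · simp [Gate.eval, slotOp, slotWt, wval, hc0]
    · simp only [Gate.eval, List.map_cons, List.map_nil, List.sum_cons, List.sum_nil, add_zero,
        Fin.sum_univ_two, slotOp, slotWt, wval, Matrix.cons_val_zero, Matrix.cons_val_one,
        hc0, htr, smul_eq_C_mul, pderiv_C_mul]
      simp
    · simp only [Gate.eval, List.map_cons, List.map_nil, List.sum_cons, List.sum_nil, add_zero,
        Fin.sum_univ_two, slotOp, slotWt, wval, Matrix.cons_val_zero, Matrix.cons_val_one,
        htr, map_add, smul_eq_C_mul, pderiv_C_mul]
    · exfalso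
      simp [Gate.fanIn, Gate.args] at hg
  · rcases args with _ | ⟨u, _ | ⟨w, _ | ⟨c, l⟩⟩⟩
    · simp [Gate.eval, slotOp, slotWt, wval, hc0]
    · simp only [Gate.eval, List.map_cons, List.map_nil, List.prod_cons, List.prod_nil, mul_one,
        Fin.sum_univ_two, slotOp, slotWt, wval, Matrix.cons_val_zero, Matrix.cons_val_one,
        hc0, htr]
      simp
    · simp only [Gate.eval, List.map_cons, List.map_nil, List.prod_cons, List.prod_nil, mul_one,
        Fin.sum_univ_two, slotOp, slotWt, wval, Matrix.cons_val_zero, Matrix.cons_val_one,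
        htr, pderiv_mul]
      ring
    · exfalso
      simp [Gate.fanIn, Gate.args] at hg

/-- One slot regrouped: `weight × ∂(slot operand) = varInd · + ∑_j gateInd · ∂ v_j`. [folklore] -/
theorem slot_regroup (V : List (MvPolynomial σ k)) {u : Operand k σ} {p : ℕ} (hu : u.RefsBelow p)
    (w : MvPolynomial σ k) (x : σ) :
    w * pderiv x (u.eval V) =
      varInd u x w + ∑ j ∈ Finset.range p, gateInd u j w * pderiv x (V.getD j 0) := by
  cases u with
  | var y =>
    simp only [Operand.eval, varInd, gateInd, zero_mul, Finset.sum_const_zero, add_zero]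
    rw [pderiv_X]
    by_cases h : y = x
    · subst h; simp
    · rw [if_neg h, Pi.single_eq_of_ne h, mul_zero]
  | const c =>
    simp [Operand.eval, varInd, gateInd]
  | gate j =>
    rw [refsBelow_gate_iff] at hu
    simp only [Operand.eval_gate, varInd, gateInd, zero_add, ite_mul, zero_mul]
    rw [Finset.sum_ite_eq, if_pos (Finset.mem_range.2 hu)]

/-- **Forward tangents.** For an original gate `p` (fan-in two):
`∂ v_p/∂x = b(p, x) + ∑_{j < p} M(p, j) ∂ v_j/∂x` in the value list of the derivative
gate list. [cite: AlonKumarVolk2020, Thm. 21] -/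
theorem tangent_recurrence (gs : List (Gate k σ)) (hfan : ∀ g ∈ gs, g.fanIn ≤ 2) {p : ℕ}
    (hp : p < gs.length) (x : σ) :
    pderiv x ((gateValues (derivGates gs)).getD p 0) =
      bw (gateValues (derivGates gs)) gs p x +
        ∑ j ∈ Finset.range p, Mw (gateValues (derivGates gs)) gs p j *
          pderiv x ((gateValues (derivGates gs)).getD j 0) := by
  set V := gateValues (derivGates gs) with hV
  have hpD : p < (derivGates gs).length := by
    simp only [derivGates, List.length_append]; omega
  have hval : V.getD p 0 = (gs[p]).eval (V.take p) := by
    rw [hV, getD_gateValues _ hpD, gateValues_take _ hpD.le]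
    congr 1
    simp only [derivGates]
    exact List.getElem_append_left hp
  have hg : gs.getD p (.prod []) = gs[p] := by
    rw [List.getD_eq_getElem?_getD, List.getElem?_eq_getElem hp, Option.getD_some]
  have hlen : p ≤ V.length := by
    rw [hV, gateValues_length]; exact hpD.le
  rw [hval, pderiv_gate_eval _ (hfan _ (List.getElem_mem hp)) V hlen x]
  simp only [bw, Mw, hg]
  have hsw : ∑ j ∈ Finset.range p, (∑ i : Fin 2, gateInd (slotOp gs[p] p i) j
      (wval V (slotWt gs[p] p i))) * pderiv x (V.getD j 0) =
      ∑ i : Fin 2, ∑ j ∈ Finset.range p, gateInd (slotOp gs[p] p i) j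
        (wval V (slotWt gs[p] p i)) * pderiv x (V.getD j 0) := by
    simp only [Finset.sum_mul]
    rw [Finset.sum_comm]
  rw [hsw, ← Finset.sum_add_distrib]
  exact Finset.sum_congr rfl fun i _ => slot_regroup V (slotOp_refsBelow _ p i) _ x

end Tangents

section Duality

/-- **The transposition (duality) identity behind reverse-mode differentiation**: if the
tangents satisfy the forward triangular system `T_p = b_p + ∑_{j<p} M_{pj} T_j` and the
adjoints the backward one `ā_j = e_j + ∑_{p>j} ā_p M_{pj}`, then `∑ e_j T_j = ∑ ā_p b_p`.
[cite: AlonKumarVolk2020, Thm. 21] -/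
theorem duality {R : Type*} [CommRing R] (s : ℕ) (e ā T b : ℕ → R) (M : ℕ → ℕ → R)
    (hT : ∀ p < s, T p = b p + ∑ j ∈ Finset.range p, M p j * T j)
    (hA : ∀ j < s, ā j = e j + ∑ p ∈ Finset.Ico (j + 1) s, ā p * M p j) :
    ∑ j ∈ Finset.range s, e j * T j = ∑ p ∈ Finset.range s, ā p * b p := by
  have h1 : ∑ j ∈ Finset.range s, ā j * T j =
      ∑ j ∈ Finset.range s, e j * T j +
        ∑ j ∈ Finset.range s, ∑ p ∈ Finset.Ico (j + 1) s, ā p * M p j * T j := by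
    rw [← Finset.sum_add_distrib]
    refine Finset.sum_congr rfl fun j hj => ?_
    rw [hA j (Finset.mem_range.1 hj), add_mul, Finset.sum_mul]
  have h2 : ∑ p ∈ Finset.range s, ā p * T p =
      ∑ p ∈ Finset.range s, ā p * b p +
        ∑ p ∈ Finset.range s, ∑ j ∈ Finset.range p, ā p * M p j * T j := by
    rw [← Finset.sum_add_distrib]
    refine Finset.sum_congr rfl fun p hp => ?_
    rw [hT p (Finset.mem_range.1 hp), mul_add, Finset.mul_sum]
    congr 1
    exact Finset.sum_congr rfl fun j _ => by ring
  have h3 : ∑ j ∈ Finset.range s, ∑ p ∈ Finset.Ico (j + 1) s, ā p * M p j * T j =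
      ∑ p ∈ Finset.range s, ∑ j ∈ Finset.range p, ā p * M p j * T j := by
    refine Finset.sum_comm' fun j p => ?_
    simp only [Finset.mem_range, Finset.mem_Ico]
    omega
  rw [h3] at h1
  have := h1.symm.trans h2
  exact add_right_cancel this

end Duality

section Correctness

variable {k : Type u} {σ : Type v} [CommRing k] [DecidableEq σ]

/-- **Correctness of the Baur–Strassen sweep**: `derivOut gs x` computes `∂f/∂x`, where `f`
is the value of the last original gate. [cite: AlonKumarVolk2020, Thm. 21 (1)] -/
theorem derivOut_eval (gs : List (Gate k σ)) (hfan : ∀ g ∈ gs, g.fanIn ≤ 2) (hs : 0 < gs.length)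
    (x : σ) :
    (derivOut gs x).eval (gateValues (derivGates gs)) =
      pderiv x ((gateValues (derivGates gs)).getD (gs.length - 1) 0) := by
  set V := gateValues (derivGates gs)
  have hd := duality (R := MvPolynomial σ k) gs.length (fun j => if j + 1 = gs.length then 1 else 0)
    (fun j => ((bsFinal gs).acc j).eval V) (fun j => pderiv x (V.getD j 0)) (fun p => bw V gs p x)
    (Mw V gs) (fun p hp => tangent_recurrence gs hfan hp x) (fun j _ => adjoint_recurrence gs j)
  rw [derivOut_eq_sum, ← hd]
  have : ∀ j ∈ Finset.range gs.length, (if j + 1 = gs.length then (1 : MvPolynomial σ k) else 0) *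
      pderiv x (V.getD j 0) = if j = gs.length - 1 then pderiv x (V.getD j 0) else 0 := by
    intro j _
    by_cases h : j = gs.length - 1
    · rw [if_pos h, if_pos (by omega), one_mul]
    · rw [if_neg h, if_neg (by omega), zero_mul]
  rw [Finset.sum_congr rfl this, Finset.sum_ite_eq', if_pos (Finset.mem_range.2 (by omega))]

/-- The original values are the first `s` values of the derivative gate list. [folklore] -/
theorem getD_gateValues_derivGates (gs : List (Gate k σ)) {j : ℕ} (hj : j < gs.length) :
    (gateValues (derivGates gs)).getD j 0 = (gateValues gs).getD j 0 := by
  unfold derivGates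
  rw [List.getD_eq_getElem?_getD, List.getD_eq_getElem?_getD,
    getElem?_of_prefix (gateValues_prefix gs (bsFinal gs).extra) (by rw [gateValues_length]; exact hj)]

end Correctness


/-! ### Fan-in and syntactic multilinearity of the derivative gate list -/

section Syntactic

variable {k : Type u} {σ : Type v} [CommSemiring k] [DecidableEq σ]

omit [DecidableEq σ] in
/-- The new gates have fan-in two. [folklore] -/
theorem mkGates_fanIn (s : ℕ) (E : List (Gate k σ)) (old a : Operand k σ) (wt : Weight k σ) :
    ∀ g ∈ (mkGates s E old a wt).1, g.fanIn ≤ 2 := by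
  cases wt <;> simp [mkGates, Gate.fanIn, Gate.args]

/-- `push` keeps fan-in two. [folklore] -/
theorem push_fanIn {s : ℕ} {st : BSState k σ} (h : ∀ g ∈ st.extra, g.fanIn ≤ 2) (a u : Operand k σ)
    (wt : Weight k σ) : ∀ g ∈ (push s st a u wt).extra, g.fanIn ≤ 2 := by
  cases u with
  | const c => simpa [push] using h
  | gate j =>
    intro g hg
    simp only [push, List.mem_append] at hg
    exact hg.elim (h g) (mkGates_fanIn _ _ _ _ _ g)
  | var x =>
    intro g hg
    simp only [push, List.mem_append] at hg
    exact hg.elim (h g) (mkGates_fanIn _ _ _ _ _ g)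

/-- The sweep keeps fan-in two. [folklore] -/
theorem run_fanIn (gs : List (Gate k σ)) (r : ℕ) : ∀ g ∈ (run gs r).extra, g.fanIn ≤ 2 := by
  induction r with
  | zero => simp [run]
  | succ r ih =>
    simp only [run]
    unfold step
    cases gs[gs.length - 1 - r]? with
    | none => exact ih
    | some g => exact push_fanIn (push_fanIn ih _ _ _) _ _ _

/-- **Fan-in two of `Ψ'`.** [cite: AlonKumarVolk2020, Thm. 21] -/
theorem derivGates_fanIn (gs : List (Gate k σ)) (hfan : ∀ g ∈ gs, g.fanIn ≤ 2) :
    ∀ g ∈ derivGates gs, g.fanIn ≤ 2 := by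
  intro g hg
  simp only [derivGates, List.mem_append] at hg
  exact hg.elim (hfan g) (run_fanIn gs gs.length g)

/-- Consistency of a list of variable sets with gates placed at offset `s`. [folklore] -/
def VarCons (VS : List (Finset σ)) (s : ℕ) (Efin : List (Gate k σ)) : Prop :=
  ∀ t g, Efin[t]? = some g → VS.getD (s + t) ∅ = gateVarSet (VS.take (s + t)) g

/-- The variable set of a weight. [folklore] -/
def wvs (VS : List (Finset σ)) : Weight k σ → Finset σ
  | .coef _ => ∅
  | .opnd w => operandVarSet VS w

omit [CommSemiring k] in
/-- The variable set of a two-operand weighted sum gate. [folklore] -/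
theorem gateVarSet_sum_two (vs : List (Finset σ)) (c₁ c₂ : k) (u₁ u₂ : Operand k σ) :
    gateVarSet vs (.sum [(c₁, u₁), (c₂, u₂)]) = operandVarSet vs u₁ ∪ operandVarSet vs u₂ := by
  simp [gateVarSet, Gate.args]

omit [CommSemiring k] in
/-- The variable set of a two-operand product gate. [folklore] -/
theorem gateVarSet_prod_two (vs : List (Finset σ)) (u₁ u₂ : Operand k σ) :
    gateVarSet vs (.prod [u₁, u₂]) = operandVarSet vs u₁ ∪ operandVarSet vs u₂ := by
  simp [gateVarSet, Gate.args]

omit [CommSemiring k] [DecidableEq σ] in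
/-- The variable set of a gate reference. [folklore] -/
@[simp] theorem operandVarSet_gate (vs : List (Finset σ)) (j : ℕ) :
    operandVarSet vs (Operand.gate j : Operand k σ) = vs.getD j ∅ := rfl

/-- **Variable set of the result of `mkGates`**: `vars(old) ∪ vars(a) ∪ vars(wt)`. [folklore] -/
theorem mkGates_varset {s : ℕ} {E Efin : List (Gate k σ)} {old a : Operand k σ} {wt : Weight k σ}
    (VS : List (Finset σ)) (hpre : E ++ (mkGates s E old a wt).1 <+: Efin)
    (hVS : VarCons VS s Efin) (hold : old.RefsBelow (s + E.length)) (ha : a.RefsBelow (s + E.length))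
    (hwt : wt.RefsBelow (s + E.length)) :
    operandVarSet VS (mkGates s E old a wt).2 =
      operandVarSet VS old ∪ operandVarSet VS a ∪ wvs VS wt := by
  cases wt with
  | coef c =>
    have h0 : Efin[E.length]? = some (.sum [(1, old), (c, a)]) := by
      rw [getElem?_of_prefix hpre (by simp [mkGates])]
      simp [mkGates]
    simp only [mkGates, operandVarSet_gate, wvs, Finset.union_empty]
    rw [hVS _ _ h0, gateVarSet_sum_two, operandVarSet_take_of_refsBelow old VS hold,
      operandVarSet_take_of_refsBelow a VS ha]
  | opnd w =>
    have h0 : Efin[E.length]? = some (.prod [a, w]) := by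
      rw [getElem?_of_prefix hpre (by simp [mkGates])]
      simp [mkGates]
    have h1 : Efin[E.length + 1]? = some (.sum [(1, old), (1, .gate (s + E.length))]) := by
      rw [getElem?_of_prefix hpre (by simp [mkGates])]
      simp [mkGates]
    simp only [mkGates, operandVarSet_gate, wvs]
    rw [show s + E.length + 1 = s + (E.length + 1) by omega, hVS _ _ h1, gateVarSet_sum_two,
      operandVarSet_take_of_refsBelow old VS (refsBelow_mono hold (by omega)),
      operandVarSet_take_of_refsBelow (Operand.gate (s + E.length)) VS (by simp),
      operandVarSet_gate, hVS _ _ h0, gateVarSet_prod_two, operandVarSet_take_of_refsBelow a VS ha,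
      operandVarSet_take_of_refsBelow w VS hwt, Finset.union_assoc]

omit [DecidableEq σ] in
/-- The new product gate made by `mkGates` (operand weight) and where it sits. [folklore] -/
theorem mkGates_prod_mem {s : ℕ} {E : List (Gate k σ)} {old a : Operand k σ} {wt : Weight k σ}
    {t : ℕ} {args : List (Operand k σ)}
    (h : (E ++ (mkGates s E old a wt).1)[t]? = some (.prod args)) (ht : E.length ≤ t) :
    ∃ w, wt = .opnd w ∧ t = E.length ∧ args = [a, w] := by
  cases wt with
  | coef c =>
    exfalso
    rw [List.getElem?_append_right ht] at h
    simp only [mkGates] at h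
    rcases Nat.eq_zero_or_pos (t - E.length) with h0 | h0
    · rw [h0] at h; simp at h
    · rw [List.getElem?_eq_none (by simp; omega)] at h; simp at h
  | opnd w =>
    rw [List.getElem?_append_right ht] at h
    simp only [mkGates] at h
    rcases Nat.eq_zero_or_pos (t - E.length) with h0 | h0
    · rw [h0] at h
      simp only [List.getElem?_cons_zero, Option.some.injEq, Gate.prod.injEq] at h
      exact ⟨w, rfl, by omega, h.symm⟩
    · exfalso
      rcases (show t - E.length = 1 ∨ 2 ≤ t - E.length by omega) with h1 | h1
      · rw [h1] at h; simp at h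
      · rw [List.getElem?_eq_none (by simp; omega)] at h; simp at h

/-- The syntactic invariant of the sweep, relative to the final variable sets `VS` and the
original variable sets `X_j = VS[j]`: adjoint accumulators avoid the variables of their gate,
derivative accumulators avoid their variable, and the new product gates multiply disjoint
variable sets. [cite: AlonKumarVolk2020, Thm. 21 (3)-(4)] -/
def BSState.SInv (VS : List (Finset σ)) (s : ℕ) (st : BSState k σ) : Prop :=
  (∀ j < s, Disjoint (operandVarSet VS (st.acc j)) (VS.getD j ∅)) ∧
    (∀ x, x ∉ operandVarSet VS (st.dacc x)) ∧
    (∀ (t : ℕ) (args : List (Operand k σ)), st.extra[t]? = some (.prod args) →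
      (args.map (operandVarSet (VS.take (s + t)))).Pairwise Disjoint)

/-- What a push needs to know about the slot `(u, wt)` of gate `p`. [folklore] -/
def PushFacts (VS : List (Finset σ)) (p : ℕ) (u : Operand k σ) (wt : Weight k σ) : Prop :=
  (∀ j, u = .gate j → j < p ∧ VS.getD j ∅ ⊆ VS.getD p ∅ ∧ Disjoint (VS.getD j ∅) (wvs VS wt)) ∧
    (∀ x, u = .var x → x ∈ VS.getD p ∅ ∧ x ∉ wvs VS wt) ∧
    (∀ w, wt = .opnd w → operandVarSet VS w ⊆ VS.getD p ∅)

/-- **`push` preserves the syntactic invariant.** [cite: AlonKumarVolk2020, Thm. 21] -/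
theorem push_sinv {VS : List (Finset σ)} {s p : ℕ} {st : BSState k σ}
    (hst : st.SInv VS s) (hws : st.WellScoped s) {a u : Operand k σ} {wt : Weight k σ}
    {Efin : List (Gate k σ)} (hpre : (push s st a u wt).extra <+: Efin) (hVS : VarCons VS s Efin)
    (ha : a.RefsBelow (s + st.extra.length)) (hwt : wt.RefsBelow (s + st.extra.length))
    (hadisj : Disjoint (operandVarSet VS a) (VS.getD p ∅)) (hfacts : PushFacts VS p u wt) :
    (push s st a u wt).SInv VS s := by
  obtain ⟨h1, h2, h3⟩ := hst
  obtain ⟨f1, f2, f3⟩ := hfacts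
  have hwvs : Disjoint (operandVarSet VS a) (wvs VS wt) := by
    cases wt with
    | coef c => simp [wvs]
    | opnd w => exact hadisj.mono_right (f3 w rfl)
  cases u with
  | const c => exact ⟨h1, h2, h3⟩
  | gate j =>
    obtain ⟨hjp, hXjp, hXjw⟩ := f1 j rfl
    refine ⟨fun j' hj' => ?_, fun x => h2 x, fun t args ht => ?_⟩
    · simp only [push]
      by_cases hj : j' = j
      · subst hj
        rw [Function.update_self, mkGates_varset VS (by simpa [push] using hpre) hVS (hws.1 j') ha hwt,
          Finset.disjoint_union_left, Finset.disjoint_union_left]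
        exact ⟨⟨h1 j' hj', hadisj.mono_right hXjp⟩, hXjw.symm⟩
      · rw [Function.update_of_ne hj]
        exact h1 j' hj'
    · simp only [push] at ht
      by_cases hlt : t < st.extra.length
      · rw [List.getElem?_append_left hlt] at ht
        exact h3 t args ht
      · push Not at hlt
        obtain ⟨w, rfl, rfl, rfl⟩ := mkGates_prod_mem ht hlt
        simp only [List.map_cons, List.map_nil, List.pairwise_cons, List.mem_singleton,
          forall_eq, List.Pairwise.nil, and_true, List.not_mem_nil, IsEmpty.forall_iff,
          implies_true]
        rw [operandVarSet_take_of_refsBelow a VS ha, operandVarSet_take_of_refsBelow w VS hwt]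
        exact hwvs
  | var x =>
    obtain ⟨hxp, hxw⟩ := f2 x rfl
    refine ⟨fun j' hj' => h1 j' hj', fun x' => ?_, fun t args ht => ?_⟩
    · simp only [push]
      by_cases hx : x' = x
      · subst hx
        rw [Function.update_self, mkGates_varset VS (by simpa [push] using hpre) hVS (hws.2.1 x') ha hwt,
          Finset.mem_union, Finset.mem_union, not_or, not_or]
        exact ⟨⟨h2 x', fun h => Finset.disjoint_left.1 hadisj h hxp⟩, hxw⟩
      · rw [Function.update_of_ne hx]
        exact h2 x'
    · simp only [push] at ht
      by_cases hlt : t < st.extra.length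
      · rw [List.getElem?_append_left hlt] at ht
        exact h3 t args ht
      · push Not at hlt
        obtain ⟨w, rfl, rfl, rfl⟩ := mkGates_prod_mem ht hlt
        simp only [List.map_cons, List.map_nil, List.pairwise_cons, List.mem_singleton,
          forall_eq, List.Pairwise.nil, and_true, List.not_mem_nil, IsEmpty.forall_iff,
          implies_true]
        rw [operandVarSet_take_of_refsBelow a VS ha, operandVarSet_take_of_refsBelow w VS hwt]
        exact hwvs

omit [CommSemiring k] [DecidableEq σ] in
/-- A truncated operand is a gate reference only if the original was, with a small index. [folklore] -/
theorem truncate_eq_gate_iff [Zero k] (u : Operand k σ) (p j : ℕ) :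
    u.truncate p = .gate j ↔ u = .gate j ∧ j < p := by
  cases u with
  | var y => simp [Operand.truncate]
  | const c => simp [Operand.truncate]
  | gate j' =>
    by_cases h : j' < p
    · simp only [Operand.truncate, if_pos h, Operand.gate.injEq]
      constructor
      · rintro rfl; exact ⟨rfl, h⟩
      · rintro ⟨rfl, -⟩; rfl
    · simp only [Operand.truncate, if_neg h]
      constructor
      · intro h'; cases h'
      · rintro ⟨h', hj⟩; cases h'; exact absurd hj h

omit [CommSemiring k] [DecidableEq σ] in
/-- A truncated operand is a variable only if the original was. [folklore] -/
theorem truncate_eq_var_iff [Zero k] (u : Operand k σ) (p : ℕ) (x : σ) :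
    u.truncate p = .var x ↔ u = .var x := by
  cases u with
  | var y => simp [Operand.truncate]
  | const c => simp [Operand.truncate]
  | gate j' =>
    by_cases h : j' < p
    · simp [Operand.truncate, if_pos h]
    · simp [Operand.truncate, if_neg h]

/-- **The slots of an original gate satisfy `PushFacts`** (this is where the syntactic
multilinearity of the original circuit enters). Here `VS` is any list of variable sets
extending `gateVarSets gs`. [cite: AlonKumarVolk2020, Thm. 21] -/
theorem slot_pushFacts (gs : List (Gate k σ))
    (hsm : ∀ (i : ℕ) (args : List (Operand k σ)), gs[i]? = some (.prod args) →
      (args.map (operandVarSet (gateVarSets (gs.take i)))).Pairwise Disjoint)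
    (VS : List (Finset σ)) (hVS : gateVarSets gs <+: VS) {p : ℕ} (hp : p < gs.length) (i : Fin 2) :
    PushFacts VS p (slotOp gs[p] p i) (slotWt gs[p] p i) := by
  -- the first `s` entries of `VS` are the original variable sets
  have hX : ∀ j < gs.length, VS.getD j ∅ = (gateVarSets gs).getD j ∅ := by
    intro j hj
    rw [List.getD_eq_getElem?_getD, List.getD_eq_getElem?_getD,
      getElem?_of_prefix hVS (by rw [RazYehudayoff.length_gateVarSets]; exact hj)]
  have htake : VS.take p = gateVarSets (gs.take p) := by
    rw [gateVarSets_take gs hp.le]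
    obtain ⟨t, ht⟩ := hVS
    rw [← ht, List.take_append_of_le_length (by rw [RazYehudayoff.length_gateVarSets]; exact hp.le)]
  have hlenp : p ≤ VS.length := by
    have := hVS.length_le; rw [RazYehudayoff.length_gateVarSets] at this; omega
  -- facts about an original operand `u₀ ∈ args gs[p]`
  have hgate : ∀ u₀ ∈ (gs[p]).args, ∀ j, u₀.truncate p = .gate j →
      j < p ∧ VS.getD j ∅ ⊆ VS.getD p ∅ ∧ VS.getD j ∅ = operandVarSet (VS.take p) u₀ := by
    intro u₀ hu₀ j hj
    obtain ⟨rfl, hjp⟩ := (truncate_eq_gate_iff u₀ p j).1 hj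
    refine ⟨hjp, ?_, ?_⟩
    · rw [hX j (hjp.trans hp), hX p hp]
      exact gateVarSets_mono_of_mem_args gs hp hjp hu₀
    · rw [operandVarSet_take_of_refsBelow (Operand.gate j) VS (n := p) hjp]
      rfl
  have hvar : ∀ u₀ ∈ (gs[p]).args, ∀ x, u₀.truncate p = .var x →
      x ∈ VS.getD p ∅ ∧ {x} = operandVarSet (VS.take p) u₀ := by
    intro u₀ hu₀ x hx
    obtain rfl := (truncate_eq_var_iff u₀ p x).1 hx
    refine ⟨?_, rfl⟩
    rw [hX p hp, getD_gateVarSets gs hp]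
    exact operandVarSet_subset_gateVarSet _ _ hu₀ (Finset.mem_singleton_self x)
  have hsub : ∀ u₀ ∈ (gs[p]).args, operandVarSet VS (u₀.truncate p) ⊆ VS.getD p ∅ := by
    intro u₀ hu₀
    rw [operandVarSet_truncate u₀ VS hlenp, hX p hp, getD_gateVarSets gs hp, htake]
    exact operandVarSet_subset_gateVarSet _ _ hu₀
  -- trivial facts for a constant slot / scalar weight
  have hconst : ∀ c : k, PushFacts VS p (Operand.const c) (Weight.coef c) := by
    intro c
    refine ⟨fun j h => ?_, fun x h => ?_, fun w h => ?_⟩ <;> cases h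
  have hcoef : ∀ u₀ ∈ (gs[p]).args, ∀ c : k, PushFacts VS p (u₀.truncate p) (Weight.coef c) := by
    intro u₀ hu₀ c
    refine ⟨fun j hj => ?_, fun x hx => ?_, fun w h => by cases h⟩
    · obtain ⟨h1, h2, -⟩ := hgate u₀ hu₀ j hj
      exact ⟨h1, h2, by simp [wvs]⟩
    · exact ⟨(hvar u₀ hu₀ x hx).1, by simp [wvs]⟩
  -- the product case with two operands
  have hprod : ∀ u₀ w₀ : Operand k σ, gs[p] = .prod [u₀, w₀] →
      PushFacts VS p (u₀.truncate p) (Weight.opnd (w₀.truncate p)) ∧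
        PushFacts VS p (w₀.truncate p) (Weight.opnd (u₀.truncate p)) := by
    intro u₀ w₀ hg
    have hargs : (gs[p]).args = [u₀, w₀] := by rw [hg]; rfl
    have hu₀ : u₀ ∈ (gs[p]).args := by rw [hargs]; simp
    have hw₀ : w₀ ∈ (gs[p]).args := by rw [hargs]; simp
    have hdisj : Disjoint (operandVarSet (VS.take p) u₀) (operandVarSet (VS.take p) w₀) := by
      have := hsm p [u₀, w₀] (by rw [List.getElem?_eq_getElem hp, hg])
      rw [← htake] at this
      simpa using this
    have hwu : operandVarSet VS (w₀.truncate p) = operandVarSet (VS.take p) w₀ :=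
      operandVarSet_truncate w₀ VS hlenp
    have huw : operandVarSet VS (u₀.truncate p) = operandVarSet (VS.take p) u₀ :=
      operandVarSet_truncate u₀ VS hlenp
    constructor
    · refine ⟨fun j hj => ?_, fun x hx => ?_, fun w hw => ?_⟩
      · obtain ⟨h1, h2, h3⟩ := hgate u₀ hu₀ j hj
        refine ⟨h1, h2, ?_⟩
        simp only [wvs]
        rw [h3, hwu]
        exact hdisj
      · obtain ⟨h1, h2⟩ := hvar u₀ hu₀ x hx
        refine ⟨h1, ?_⟩
        simp only [wvs]
        rw [hwu]
        have := Finset.disjoint_left.1 hdisj (h2 ▸ Finset.mem_singleton_self x)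
        exact this
      · cases hw
        exact hsub w₀ hw₀
    · refine ⟨fun j hj => ?_, fun x hx => ?_, fun w hw => ?_⟩
      · obtain ⟨h1, h2, h3⟩ := hgate w₀ hw₀ j hj
        refine ⟨h1, h2, ?_⟩
        simp only [wvs]
        rw [h3, huw]
        exact hdisj.symm
      · obtain ⟨h1, h2⟩ := hvar w₀ hw₀ x hx
        refine ⟨h1, ?_⟩
        simp only [wvs]
        rw [huw]
        have := Finset.disjoint_right.1 hdisj (h2 ▸ Finset.mem_singleton_self x)
        exact this
      · cases hw
        exact hsub u₀ hu₀
  -- case analysis on the shape of the gate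
  rcases hg : gs[p] with args | args
  · have hmem : ∀ a ∈ args, a.2 ∈ (gs[p]).args := fun a ha => by
      rw [hg]; exact List.mem_map.2 ⟨a, ha, rfl⟩
    rcases args with _ | ⟨a, _ | ⟨b, _ | ⟨c, l⟩⟩⟩ <;> fin_cases i
    all_goals simp only [slotOp, slotWt, Matrix.cons_val_zero, Matrix.cons_val_one, Fin.zero_eta,
      Fin.mk_one, Fin.isValue]
    · exact hconst 0
    · exact hconst 0
    · exact hcoef a.2 (hmem a (by simp)) a.1
    · exact hconst 0
    · exact hcoef a.2 (hmem a (by simp)) a.1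
    · exact hcoef b.2 (hmem b (by simp)) b.1
    · exact hconst 0
    · exact hconst 0
  · have hmem : ∀ u ∈ args, u ∈ (gs[p]).args := fun u hu => by rw [hg]; exact hu
    rcases args with _ | ⟨u₀, _ | ⟨w₀, _ | ⟨c, l⟩⟩⟩ <;> fin_cases i
    all_goals simp only [slotOp, slotWt, Matrix.cons_val_zero, Matrix.cons_val_one, Fin.zero_eta,
      Fin.mk_one, Fin.isValue]
    · exact hconst 0
    · exact hconst 0
    · exact hcoef u₀ (hmem u₀ (by simp)) 1
    · exact hconst 0
    · exact (hprod u₀ w₀ hg).1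
    · exact (hprod u₀ w₀ hg).2
    · exact hconst 0
    · exact hconst 0

end Syntactic


section Assembly

variable {k : Type u} {σ : Type v} [CommSemiring k] [DecidableEq σ]

/-- **`step` preserves the syntactic invariant.** [cite: AlonKumarVolk2020, Thm. 21] -/
theorem step_sinv {gs : List (Gate k σ)}
    (hsm : ∀ (i : ℕ) (args : List (Operand k σ)), gs[i]? = some (.prod args) →
      (args.map (operandVarSet (gateVarSets (gs.take i)))).Pairwise Disjoint)
    {VS : List (Finset σ)} (hVSpre : gateVarSets gs <+: VS) {st : BSState k σ}
    (hst : st.SInv VS gs.length) (hws : st.WellScoped gs.length) {p : ℕ} (hp : p < gs.length)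
    {Efin : List (Gate k σ)} (hpre : (step gs st p).extra <+: Efin) (hVS : VarCons VS gs.length Efin) :
    (step gs st p).SInv VS gs.length := by
  rw [step_eq_of_lt gs st hp] at hpre ⊢
  set st₁ := push gs.length st (st.acc p) (slotOp gs[p] p 0) (slotWt gs[p] p 0) with hst₁
  have ha : (st.acc p).RefsBelow (gs.length + st.extra.length) := hws.1 p
  have hadisj : Disjoint (operandVarSet VS (st.acc p)) (VS.getD p ∅) := hst.1 p hp
  have hpre₁ : st₁.extra <+: Efin := (push_extra_prefix _ _ _ _ _).trans hpre
  have hlen₁ : st.extra.length ≤ st₁.extra.length := (push_extra_prefix _ _ _ _ _).length_le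
  have hwt0 : (slotWt gs[p] p 0).RefsBelow (gs.length + st.extra.length) :=
    Weight.refsBelow_mono (slotWt_refsBelow _ p 0) (by omega)
  have hst₁ws : st₁.WellScoped gs.length := push_wellScoped hws ha hwt0
  have hst₁si : st₁.SInv VS gs.length :=
    push_sinv hst hws hpre₁ hVS ha hwt0 hadisj (slot_pushFacts gs hsm VS hVSpre hp 0)
  exact push_sinv hst₁si hst₁ws hpre hVS (refsBelow_mono ha (by omega))
    (Weight.refsBelow_mono (slotWt_refsBelow _ p 1) (by omega)) hadisj
    (slot_pushFacts gs hsm VS hVSpre hp 1)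

/-- The variable-set list of the derivative gate list is consistent with the new gates. [folklore] -/
theorem varCons_derivGates (gs : List (Gate k σ)) :
    VarCons (gateVarSets (derivGates gs)) gs.length (bsFinal gs).extra := by
  intro t g hg
  have ht : t < (bsFinal gs).extra.length := (List.getElem?_eq_some_iff.1 hg).1
  have hlt : gs.length + t < (derivGates gs).length := by
    simp only [derivGates, List.length_append]; omega
  rw [getD_gateVarSets _ hlt, gateVarSets_take _ hlt.le]
  congr 1
  simp only [derivGates]
  rw [List.getElem_append_right (by omega)]
  have := (List.getElem?_eq_some_iff.1 hg).2
  simp only [Nat.add_sub_cancel_left]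
  exact this

/-- **The syntactic invariant holds along the sweep.** [cite: AlonKumarVolk2020, Thm. 21] -/
theorem run_sinv {gs : List (Gate k σ)}
    (hsm : ∀ (i : ℕ) (args : List (Operand k σ)), gs[i]? = some (.prod args) →
      (args.map (operandVarSet (gateVarSets (gs.take i)))).Pairwise Disjoint)
    {r : ℕ} (hr : r ≤ gs.length) : (run gs r).SInv (gateVarSets (derivGates gs)) gs.length := by
  have hVSpre : gateVarSets gs <+: gateVarSets (derivGates gs) := foldSnoc_prefix _ _ _
  induction r with
  | zero =>
    refine ⟨fun j _ => ?_, fun x => ?_, fun t args ht => ?_⟩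
    · simp only [run]
      split_ifs <;> simp [operandVarSet]
    · simp [run, operandVarSet]
    · simp [run] at ht
  | succ r ih =>
    have hrun : run gs (r + 1) = step gs (run gs r) (gs.length - 1 - r) := rfl
    rw [hrun]
    refine step_sinv hsm hVSpre (ih (by omega)) (run_wellScoped gs r) (by omega) ?_
      (varCons_derivGates gs)
    rw [← hrun]
    exact run_extra_prefix gs hr

/-- **`Ψ'` is syntactically multilinear** (as a gate list). [cite: AlonKumarVolk2020, Thm. 21 (3)] -/
theorem derivGates_sm {gs : List (Gate k σ)}
    (hsm : ∀ (i : ℕ) (args : List (Operand k σ)), gs[i]? = some (.prod args) →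
      (args.map (operandVarSet (gateVarSets (gs.take i)))).Pairwise Disjoint)
    (i : ℕ) (args : List (Operand k σ)) (hi : (derivGates gs)[i]? = some (.prod args)) :
    (args.map (operandVarSet (gateVarSets ((derivGates gs).take i)))).Pairwise Disjoint := by
  by_cases hlt : i < gs.length
  · have h1 : (derivGates gs)[i]? = gs[i]? := by
      simp only [derivGates]; exact List.getElem?_append_left hlt
    have h2 : (derivGates gs).take i = gs.take i := by
      simp only [derivGates]; exact List.take_append_of_le_length hlt.le
    rw [h2]
    exact hsm i args (h1 ▸ hi)
  · push Not at hlt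
    have h1 : (derivGates gs)[i]? = (bsFinal gs).extra[i - gs.length]? := by
      simp only [derivGates]; exact List.getElem?_append_right hlt
    rw [h1] at hi
    have hlen : i - gs.length < (bsFinal gs).extra.length := (List.getElem?_eq_some_iff.1 hi).1
    have := (run_sinv hsm le_rfl).2.2 (i - gs.length) args hi
    rw [show gs.length + (i - gs.length) = i by omega, ← gateVarSets_take] at this
    · exact this
    · simp only [derivGates, List.length_append]; omega

/-- **The output `∂f/∂x` does not depend on `x` syntactically.** [cite: AlonKumarVolk2020, Thm. 21 (4)] -/
theorem not_mem_operandVarSet_derivOut {gs : List (Gate k σ)}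
    (hsm : ∀ (i : ℕ) (args : List (Operand k σ)), gs[i]? = some (.prod args) →
      (args.map (operandVarSet (gateVarSets (gs.take i)))).Pairwise Disjoint)
    (x : σ) : x ∉ operandVarSet (gateVarSets (derivGates gs)) (derivOut gs x) :=
  (run_sinv hsm le_rfl).2.1 x

/-- The output operands refer inside the derivative gate list. [folklore] -/
theorem derivOut_refsBelow (gs : List (Gate k σ)) (x : σ) :
    (derivOut gs x).RefsBelow (derivGates gs).length := by
  have := (run_wellScoped gs gs.length).2.1 x
  simp only [derivGates, List.length_append]
  exact this

/-- **The derivative circuit for `x`**: the derivative gate list with output `∂f/∂x`. [cite: AlonKumarVolk2020, Thm. 21] -/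
def derivCircuit (P : ArithCircuit k σ) (x : σ) : ArithCircuit k σ :=
  ⟨derivGates P.gates, derivOut P.gates x⟩

/-- The derivative circuits have fan-in two. [cite: AlonKumarVolk2020, Thm. 21] -/
theorem derivCircuit_isFanInTwo {P : ArithCircuit k σ} (h2 : P.IsFanInTwo) (x : σ) :
    (derivCircuit P x).IsFanInTwo :=
  derivGates_fanIn P.gates h2

/-- The derivative circuits are syntactically multilinear. [cite: AlonKumarVolk2020, Thm. 21 (3)] -/
theorem derivCircuit_sm {P : ArithCircuit k σ} (hsm : IsSyntacticallyMultilinear P) (x : σ) :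
    IsSyntacticallyMultilinear (derivCircuit P x) :=
  fun i args hi => derivGates_sm hsm i args hi

/-- The derivative circuits have size `≤ 5 |P|`. [cite: AlonKumarVolk2020, Thm. 21 (2)] -/
theorem derivCircuit_size_le (P : ArithCircuit k σ) (x : σ) : (derivCircuit P x).size ≤ 5 * P.size :=
  derivGates_length_le P.gates

end Assembly

section AssemblyRing

variable {k : Type u} {σ : Type v} [CommRing k] [DecidableEq σ]

/-- **Multilinear Baur–Strassen (Raz–Shpilka–Yehudayoff 2008, Thm. 3.1 = [AlonKumarVolk2020,
Thm. 21]), correctness**: for a fan-in-two circuit whose output is its last gate, the derivative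
circuit for `x` computes `∂f/∂x`. [cite: AlonKumarVolk2020, Thm. 21 (1)] -/
theorem derivCircuit_eval {P : ArithCircuit k σ} (h2 : P.IsFanInTwo) (hs : 0 < P.size)
    (hout : P.output = .gate (P.size - 1)) (x : σ) :
    (derivCircuit P x).eval = pderiv x P.eval := by
  have h := derivOut_eval P.gates h2 hs x
  rw [getD_gateValues_derivGates P.gates (by simp only [ArithCircuit.size] at hs ⊢; omega)] at h
  simp only [derivCircuit, ArithCircuit.eval, hout, Operand.eval_gate, ArithCircuit.size] at h ⊢
  exact h

end AssemblyRing

end Literature.Barriers.ValiantsHypothesis.AKV
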